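import Summits.CriticalPhenomena.Ising3DConformalLimit.Theorems.FKParityRobustnessIndependentStrandsJoinCrossFatteningDefs
import Summits.CriticalPhenomena.Ising3DConformalLimit.Theorems.FKParityRobustnessIndependentStrandsJoinStubPairSplitAux
import Summits.CriticalPhenomena.Ising3DConformalLimit.Theorems.FKParityRobustnessDepletionBound
import Summits.CriticalPhenomena.Ising3DConformalLimit.Theorems.FKParityRobustnessSourceTrailsMeet
import HarnessLib

/-!
# Crux `IndependentStrandsJoin` (stmt-CriticalPhenomena-14625), line `cross-fattening-decoupling` —
# stub `stub_soupAttach`: the DICTIONARY of the un-depleted one-point mass `fullMass`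

Route `FKParityRobustness`, sub-problem `Ising3DConformalLimit`; theorem-only support file for the
registered stub `stub_soupAttach` of the skeleton `Cruxes/IndependentStrandsJoin/Lines/cross_fattening_decoupling.lean`
(vocabulary: `Theorems/FKParityRobustnessIndependentStrandsJoinCrossFatteningDefs.lean`, namespace
`…Cruxes.IndependentStrandsJoin.CrossFatteningDecoupling`: `rch`, `cl`, `offCl`, `srcClusters`, `attachFull`,
`zOff`, `zPair`, `fullMass`).

The stub asks, on the box `Λ_N ⊂ ℤ³` at `t = tanh β_c(3)` with sources `a = l • tetra` and window points `u`
(`2|uᵢ| ≤ l`), for ONE constant `c > 0`, uniform in `l ≥ 1` and `N ≥ N₀(l)`, with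
`c · Z^{a₀u} Z^{ua₁} ≤ fullMass G t a₀ a₁ u` (both copies).  This file makes the meaning of `fullMass`
exact on EVERY finite graph, for every real `t` (no limit, no lattice):

* `fullMass_eq_sum_tJoins` **(a)**: `fullMass G t x y u = Σ_{F ∈ 𝒯(xy)} Σ_{L ∈ 𝓔_∅(G)} t^{|F|+|L|}·1[x ↝_{K_x(F) ∪ L} u]`,
  i.e. `fullMass = Z^{xy}·Z^∅ · P_{ℓ^{xy} ⊗ ℓ^∅}[u ∈ C(x; K_x(F) ∪ L')]` — the one-point function of the
  STRAND CLUSTER `K_x(F) = cl F x` of `F ~ ℓ^{xy}_{G,t}` glued to an INDEPENDENT FULL soup `L' ~ ℓ^∅_{G,t}`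
  (the own soup `F ∖ K_x(F)` is discarded).  Proof: fibre the `F`-sum over the source cluster
  `K = K_x(F) ∈ srcClusters` (`DepletionBound.cluster_props`), evaluate each fibre by the landed fibre
  bijection `StubPairSplit.fibre_sum` (= `stub_pairSplitAux`, `S₀ = {x,y}`, `T = ∅`, `g F = t^{|F|}`):
  `Σ_{K_x(F) = K} t^{|F|} = t^{|K|}·Z^∅(G − V(K))` (`soupAttach_fibre_eval`; `|K ∪ R| = |K| + |R|` for `R`
  off `V(K)`, and `𝓔_∅(offCl K x) = {R ⊆ ℰ_{Λ_K} : oddVerts Λ_K R = ∅}`), and un-partition.  (The same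
  resummation is `StubCrossFactorisation.sum_tJoins_pair_eq` of the sibling stub file, landed concurrently;
  this file is kept import-independent of it.)
* `fullMass_le` **(b)**: `fullMass ≤ Z^{xy}·Z^∅` for `t ≥ 0` (the indicator dropped: `P ≤ 1`), so an admissible
  constant satisfies `c ≤ Z^{xy}Z^∅/(Z^{xu}Z^{uy})` — recorded for the refuters; no contradiction.
* `fullMass_ge_strand` **(c)** (and **(c′)** `fullMass_ge_strand'`): `Z^∅ · Σ_{F ∈ 𝒯(xy), x ↝_{K_x(F)} u} t^{|F|} ≤ fullMass`
  for `t ≥ 0`, i.e. `P[u ∈ C(x; K_x(F) ∪ L')] ≥ ℓ^{xy}[u ∈ V(K_x(F))]`: a point already on the strand cluster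
  is attached whatever the soup.  This is NOT the stub: at `β_c` in `d = 3` the bare strand is numerically too
  thin by `l^{D_HT − 2 + η} ≈ l^{-0.23}` against the double-current profile `⟨σ_xσ_u⟩⟨σ_uσ_y⟩/⟨σ_xσ_y⟩`
  (line card F2), so the soup halo `L'` is essential for an `l`-uniform constant.
* `fullMass_le_strand_conv_soup` **(d)**: the union-bound ceiling `fullMass ≤ Σ_v (Σ_{F ∈ 𝒯(xy), x ↝_F v} t^{|F|})·(Σ_{L ∈ 𝓔_∅, v ↝_L u} t^{|L|})`,
  i.e. `P[u ∈ C(x; K_x(F) ∪ L')] ≤ Σ_v ℓ^{xy}[v ∈ V(K_x(F))]·ℓ^∅[v ↔ u]` (path splitting at the last visit of `V(K)`,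
  `soupAttach_rch_union_split`): soup attachment is at most strand density convolved with soup connectivity.

Not here (deliberately): the stub itself (an open one-point LOWER bound for a critical geometric object in
`d = 3`; no named fact of the tree or of the literature implies it), and the switching-exact CEILING
`fullMass ≤ Z^{xu}·Z^{uy}` (`C(x; K ∪ L') ⊆ 𝐂_{n₁+n₂}(x)` under the odd-part coupling of currents with
loop O(1), and `P^{xy} ⊗ P^∅[u ∈ 𝐂(x)] = ⟨σ_xσ_u⟩⟨σ_uσ_y⟩/⟨σ_xσ_y⟩`, Aizenman–Duminil-Copin 2021 Prop. A.3,
first display — in the tree for currents as `Current.tsum_epairWeight_mul_clusterCount`, not transported to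
`fullMass`).

References: M. Aizenman, H. Duminil-Copin, Ann. of Math. 194 (2021), arXiv:1912.07973, Lemma 4.4 and
Prop. A.3 [AizenmanDuminilCopinAnnals2021]; U. T. Hansen, J. Jiang, F. R. Klausen, arXiv:2506.10765 §2
(sourced loop O(1), `T`-joins) [HansenJiangKlausen2025]; M. Aizenman, Comm. Math. Phys. 86 (1982) §5
(conditioning on the cluster of a source) [AizenmanCMP1982].
-/

noncomputable section

open Finset SimpleGraph
open Literature.Probability.LatticeModels


namespace Summit.CriticalPhenomena.Ising3DConformalLimit.Theorems

namespace StubSoupAttach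

open Summit.CriticalPhenomena.Ising3DConformalLimit.Cruxes.IndependentStrandsJoin.CrossFatteningDecoupling
open Summit.CriticalPhenomena.Ising3DConformalLimit.Cruxes.ParityRobustMerging.PlaquetteXorSurgery (tetra)
open scoped Classical BigOperators symmDiff

section General

variable {V : Type*} [Fintype V] [DecidableEq V] (G : SimpleGraph V) [DecidableRel G.Adj]

/-- **Fibre evaluation** (the fibre bijection `StubPairSplit.fibre_sum` = `stub_pairSplitAux` with
`S₀ = {x, y}`, `T = ∅`, `g F = t^{|F|}`): over the `T`-joins of `{x, y}` with `x`-cluster `K`,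
`Σ t^{|F|} = t^{|K|} · Z^∅(G − V(K))`, i.e. `ℓ^{xy}[K_x(F) = K] = t^{|K|} Z^∅(G − V(K)) / Z^{xy}`
(`|K ∪ R| = |K| + |R|` for `R` off `V(K)`; the even subgraphs of the depleted domain `offCl K x` are the
even subgraphs of the depleted volume `Λ_K = {w | x ↝̸_K w}` in the `edgesIn`/`oddVerts` form of the
bijection).  The vocabulary's `cl F x` is defined over a bare vertex type, hence carries the classical
decidability instance; it is bridged to the tree's filter form by extensionality (`hcl`). -/
theorem soupAttach_fibre_eval {x y : V} {K : Finset (Sym2 V)} (hK : K ∈ srcClusters G x {x, y}) (t : ℝ) :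
    ∑ F ∈ (tJoins G Set.univ {x, y}).filter (fun F => cl F x = K), t ^ #F = t ^ #K * zOff G t x K := by
  have hcl : ∀ F : Finset (Sym2 V),
      cl F x = F.filter (fun e => ∃ v ∈ e, (fromEdgeSet (↑F : Set (Sym2 V))).Reachable x v) :=
    fun F => by ext e; simp only [cl, rch, Finset.mem_filter]
  unfold srcClusters at hK
  rw [mem_filter, StubPairSplit.mem_tJoins_univ] at hK
  obtain ⟨⟨hKG, hKodd⟩, hKself⟩ := hK
  rw [hcl] at hKself
  have hfib := StubPairSplit.fibre_sum G hKG hKself hKodd (T := ∅) (empty_subset _) (fun F => t ^ #F)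
  rw [union_empty] at hfib
  -- the index set of `zOff`: even subgraphs of `offCl K x` = even subgraphs of the depleted volume
  have hidx : tJoins G (offCl K x) ∅ =
      (edgesIn G (univ.filter fun w => ¬ (fromEdgeSet (↑K : Set (Sym2 V))).Reachable x w)).powerset.filter
        (fun R => oddVerts (univ.filter fun w =>
          ¬ (fromEdgeSet (↑K : Set (Sym2 V))).Reachable x w) R = ∅) := by
    ext R
    rw [mem_tJoins, mem_filter, mem_powerset]
    constructor
    · rintro ⟨hRG, hRoff, hRodd⟩
      refine ⟨fun e he => ?_, ?_⟩
      · rw [mem_edgesIn_iff]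
        exact ⟨mem_edgeFinset.1 (hRG he), fun v hv =>
          mem_filter.2 ⟨mem_univ _, hRoff (mem_coe.2 he) v hv⟩⟩
      · rw [oddVerts, filter_eq_empty_iff]
        exact fun v _ hodd => Finset.notMem_empty v ((hRodd v).1 hodd)
    · rintro ⟨hRE, hRodd⟩
      refine ⟨fun e he => mem_edgeFinset.2 (mem_edgesIn_iff.1 (hRE he)).1,
        fun e he v hv => (mem_filter.1 ((mem_edgesIn_iff.1 (hRE (mem_coe.1 he))).2 v hv)).2,
        fun v => ⟨fun hodd => ?_, fun h => absurd h (Finset.notMem_empty v)⟩⟩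
      by_cases hv : (fromEdgeSet (↑K : Set (Sym2 V))).Reachable x v
      · -- `v ∉ Λ_K` lies on no edge of `R`
        have h0 : #(R.filter (v ∈ ·)) = 0 := by
          rw [card_eq_zero, filter_eq_empty_iff]
          exact fun e he hve => (mem_filter.1 ((mem_edgesIn_iff.1 (hRE he)).2 v hve)).2 hv
        rw [h0] at hodd
        exact absurd hodd Nat.not_odd_zero
      · rw [oddVerts, filter_eq_empty_iff] at hRodd
        exact absurd hodd (hRodd (mem_filter.2 ⟨mem_univ _, hv⟩))
  simp only [hcl]
  rw [hfib]
  unfold zOff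
  rw [hidx, Finset.mul_sum]
  refine Finset.sum_congr rfl fun R hR => ?_
  rw [mem_filter, mem_powerset] at hR
  have havoid : ∀ e ∈ R, ∀ v ∈ e, ¬ (fromEdgeSet (↑K : Set (Sym2 V))).Reachable x v :=
    fun e he v hv => StubPairSplit.mem_dVol.1 ((mem_edgesIn_iff.1 (hR.1 he)).2 v hv)
  rw [card_union_of_disjoint (StubPairSplit.disjoint_of_avoid hKself havoid), pow_add]

/-- **(a) `fullMass` as a double sum over configurations.**
`fullMass G t x y u = Σ_{F ∈ 𝒯(xy)} Σ_{L ∈ 𝓔_∅(G)} t^{|F|+|L|} 1[x ↝_{K_x(F) ∪ L} u]`, i.e.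
`fullMass = Z^{xy} Z^∅ · P_{ℓ^{xy} ⊗ ℓ^∅}[u ∈ C(x; K_x(F) ∪ L')]`: the one-point function of the STRAND
CLUSTER `K_x(F)` of `F ~ ℓ^{xy}` glued to an INDEPENDENT FULL soup `L' ~ ℓ^∅` (own soup `F ∖ K_x(F)`
discarded).  Proof: fibre the `F`-sum over `K = K_x(F) ∈ srcClusters` (`DepletionBound.cluster_props`:
`K_x(F) ⊆ E(G)` is self-clustered with odd set `{x, y}`), note that on the fibre of `K` the indicator
depends on `F` only through `K_x(F) = K`, and evaluate `Σ_{fibre} t^{|F|}` by `soupAttach_fibre_eval`. -/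
theorem fullMass_eq_sum_tJoins (t : ℝ) (x y u : V) :
    fullMass G t x y u =
      ∑ F ∈ tJoins G Set.univ {x, y}, ∑ L ∈ tJoins G Set.univ ∅,
        if rch (cl F x ∪ L) x u then t ^ (#F + #L) else 0 := by
  have hcl : ∀ F : Finset (Sym2 V),
      cl F x = F.filter (fun e => ∃ v ∈ e, (fromEdgeSet (↑F : Set (Sym2 V))).Reachable x v) :=
    fun F => by ext e; simp only [cl, rch, Finset.mem_filter]
  have hmaps : ∀ F ∈ tJoins G Set.univ {x, y}, cl F x ∈ srcClusters G x {x, y} := by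
    intro F hF
    obtain ⟨h1, h2, h3⟩ := DepletionBound.cluster_props G hF
    unfold srcClusters
    rw [mem_filter, StubPairSplit.mem_tJoins_univ]
    simp only [hcl]
    exact ⟨⟨h1, h3⟩, h2⟩
  rw [← Finset.sum_fiberwise_of_maps_to hmaps]
  unfold fullMass
  refine Finset.sum_congr rfl fun K hK => ?_
  have hinner : ∀ F ∈ (tJoins G Set.univ {x, y}).filter (fun F => cl F x = K),
      (∑ L ∈ tJoins G Set.univ ∅, if rch (cl F x ∪ L) x u then t ^ (#F + #L) else 0) =
        t ^ #F * attachFull G t x K u := by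
    intro F hF
    rw [mem_filter] at hF
    rw [hF.2]
    unfold attachFull
    rw [Finset.mul_sum]
    refine Finset.sum_congr rfl fun L _ => ?_
    split_ifs
    · exact pow_add _ _ _
    · exact (mul_zero _).symm
  rw [Finset.sum_congr rfl hinner, ← Finset.sum_mul, soupAttach_fibre_eval G hK]

/-- **(b) The trivial ceiling** `fullMass ≤ Z^{xy} · Z^∅` (drop the indicator), i.e. `P ≤ 1`: any
admissible constant `c` of the stub satisfies `c · Z^{xu}Z^{uy} ≤ Z^{xy}Z^∅`.  (The switching-exact
ceiling `fullMass ≤ Z^{xu}Z^{uy}`, from `C(x; K ∪ L') ⊆ 𝐂_{n₁+n₂}(x)` under the odd-part coupling and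
`P^{xy}⊗P^∅[u ∈ 𝐂(x)] = ⟨σ_xσ_u⟩⟨σ_uσ_y⟩/⟨σ_xσ_y⟩`, is not proved here.) -/
theorem fullMass_le {t : ℝ} (ht : 0 ≤ t) (x y u : V) :
    fullMass G t x y u ≤ loopO1PartitionFunction G t {x, y} * loopO1PartitionFunction G t ∅ := by
  rw [fullMass_eq_sum_tJoins, loopO1PartitionFunction_eq_sum_tJoins,
    loopO1PartitionFunction_eq_sum_tJoins, Finset.sum_mul_sum]
  refine Finset.sum_le_sum fun F _ => Finset.sum_le_sum fun L _ => ?_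
  rw [← pow_add]
  split_ifs
  · exact le_rfl
  · positivity

/-- **(c) The bare strand is a floor**:
`Z^∅ · Σ_{F ∈ 𝒯(xy), x ↝_{K_x(F)} u} t^{|F|} ≤ fullMass`, i.e.
`P_{ℓ^{xy} ⊗ ℓ^∅}[u ∈ C(x; K_x(F) ∪ L')] ≥ ℓ^{xy}[u ∈ V(K_x(F))]`: a point on the strand cluster is
attached whatever the soup (`rch_mono`).  This is NOT the stub: at `β_c` in `d = 3` the bare strand is
numerically too thin by `l^{D_HT − 2 + η} ≈ l^{-0.23}` against the double-current profile
`⟨σ_xσ_u⟩⟨σ_uσ_y⟩/⟨σ_xσ_y⟩`, so the soup halo `L'` is essential for an `l`-uniform constant. -/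
theorem fullMass_ge_strand {t : ℝ} (ht : 0 ≤ t) (x y u : V) :
    loopO1PartitionFunction G t ∅ *
        (∑ F ∈ (tJoins G Set.univ {x, y}).filter (fun F => rch (cl F x) x u), t ^ #F) ≤
      fullMass G t x y u := by
  rw [fullMass_eq_sum_tJoins, loopO1PartitionFunction_eq_sum_tJoins, Finset.mul_sum, Finset.sum_filter]
  refine Finset.sum_le_sum fun F _ => ?_
  split_ifs with h
  · rw [Finset.sum_mul]
    refine Finset.sum_le_sum fun L _ => ?_
    rw [if_pos (DepletionBound.rch_mono subset_union_left h), pow_add, mul_comm]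
  · exact Finset.sum_nonneg fun L _ => by
      split_ifs
      · positivity
      · exact le_rfl

/-- `x ↝_{K_x(F)} u ↔ x ↝_F u` (`DepletionBound.rch_cluster_iff`): the floor of `fullMass_ge_strand` is the
`ℓ^{xy}`-mass of `{u in the F-component of x}`. -/
theorem soupAttach_rch_cl_iff (F : Finset (Sym2 V)) (x u : V) : rch (cl F x) x u ↔ rch F x u := by
  have hcl : cl F x = F.filter (fun e => ∃ v ∈ e, (fromEdgeSet (↑F : Set (Sym2 V))).Reachable x v) := by
    ext e; simp only [cl, rch, Finset.mem_filter]
  rw [hcl]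
  exact DepletionBound.rch_cluster_iff F x u

/-- **(c′)** The same floor with the event written on `F` itself:
`Z^∅ · Σ_{F ∈ 𝒯(xy), x ↝_F u} t^{|F|} ≤ fullMass`. -/
theorem fullMass_ge_strand' {t : ℝ} (ht : 0 ≤ t) (x y u : V) :
    loopO1PartitionFunction G t ∅ *
        (∑ F ∈ (tJoins G Set.univ {x, y}).filter (fun F => rch F x u), t ^ #F) ≤
      fullMass G t x y u := by
  have h : (tJoins G Set.univ {x, y}).filter (fun F => rch F x u) =
      (tJoins G Set.univ {x, y}).filter (fun F => rch (cl F x) x u) :=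
    Finset.filter_congr fun F _ => (soupAttach_rch_cl_iff F x u).symm
  rw [h]
  exact fullMass_ge_strand G ht x y u

omit [Fintype V] in
/-- **Path splitting at the cluster.**  If `x ↝_{K ∪ L} u` and every endpoint of an edge of `K` is
`K`-reachable from `x` (e.g. `K` self-clustered at `x`), then some `K`-reachable vertex `v` is joined to
`u` inside `L` alone (follow the path; restart at every `K`-edge). -/
theorem soupAttach_rch_union_split {K L : Finset (Sym2 V)} {x u : V}
    (hK : ∀ e ∈ K, ∀ w ∈ e, rch K x w) (h : rch (K ∪ L) x u) : ∃ v, rch K x v ∧ rch L v u := by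
  change (fromEdgeSet (↑(K ∪ L) : Set (Sym2 V))).Reachable x u at h
  rw [reachable_iff_reflTransGen] at h
  induction h with
  | refl => exact ⟨x, Reachable.refl x, Reachable.refl x⟩
  | @tail b c _ hbc ih =>
    obtain ⟨v, hxv, hvb⟩ := ih
    rw [fromEdgeSet_adj] at hbc
    rcases mem_union.1 (mem_coe.1 hbc.1) with hKe | hLe
    · exact ⟨c, hK _ hKe c (Sym2.mem_mk_right b c), Reachable.refl c⟩
    · have hadj : (fromEdgeSet (↑L : Set (Sym2 V))).Adj b c := by
        rw [fromEdgeSet_adj]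
        exact ⟨mem_coe.2 hLe, hbc.2⟩
      exact ⟨v, hxv, hvb.trans hadj.reachable⟩

/-- Every endpoint of an edge of the strand cluster `K_x(F)` is `K_x(F)`-reachable from `x`
(`DepletionBound.rch_of_mem_of_self` with `DepletionBound.filter_cluster_idem`). -/
theorem soupAttach_rch_cl_of_mem (F : Finset (Sym2 V)) (x : V) :
    ∀ e ∈ cl F x, ∀ w ∈ e, rch (cl F x) x w := by
  intro e he w hw
  have hcl : cl F x = F.filter (fun e => ∃ v ∈ e, (fromEdgeSet (↑F : Set (Sym2 V))).Reachable x v) := by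
    ext e; simp only [cl, rch, Finset.mem_filter]
  rw [hcl] at he ⊢
  exact DepletionBound.rch_of_mem_of_self (DepletionBound.filter_cluster_idem F x) he hw

/-- **(d) Union-bound ceiling: soup attachment ≤ strand density ∗ soup connectivity.**
`fullMass ≤ Σ_v (Σ_{F ∈ 𝒯(xy), x ↝_F v} t^{|F|}) · (Σ_{L ∈ 𝓔_∅(G), v ↝_L u} t^{|L|})`, i.e.
`P[u ∈ C(x; K_x(F) ∪ L')] ≤ Σ_v ℓ^{xy}[v ∈ V(K_x(F))] · ℓ^∅[v ↔ u]`: a path from `x` to `u` inside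
`K ∪ L'` leaves `V(K)` for the last time at some vertex `v` and then runs inside `L'` alone
(`soupAttach_rch_union_split`), and the two indicators are functions of the independent `F` and `L'`.
With `ℓ^∅[v ↔ u] ≤ ⟨σ_vσ_u⟩²` (sourceless switching) this bounds the stub's left side by the strand
one-point function convolved with `τ²` — the quantitative form of "the soup halo must reach the strand". -/
theorem fullMass_le_strand_conv_soup {t : ℝ} (ht : 0 ≤ t) (x y u : V) :
    fullMass G t x y u ≤
      ∑ v, (∑ F ∈ (tJoins G Set.univ {x, y}).filter (fun F => rch F x v), t ^ #F) *
        (∑ L ∈ (tJoins G Set.univ ∅).filter (fun L => rch L v u), t ^ #L) := by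
  rw [fullMass_eq_sum_tJoins]
  have key : ∀ F ∈ tJoins G Set.univ {x, y}, ∀ L ∈ tJoins G Set.univ ∅,
      (if rch (cl F x ∪ L) x u then t ^ (#F + #L) else 0) ≤
        ∑ v, (if rch F x v then t ^ #F else 0) * (if rch L v u then t ^ #L else 0) := by
    intro F _ L _
    split_ifs with h
    · obtain ⟨v, hxv, hvu⟩ := soupAttach_rch_union_split (soupAttach_rch_cl_of_mem F x) h
      rw [soupAttach_rch_cl_iff] at hxv
      refine le_trans (le_of_eq ?_) (Finset.single_le_sum
        (f := fun w => (if rch F x w then t ^ #F else 0) * (if rch L w u then t ^ #L else 0))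
        (fun w _ => by positivity) (mem_univ v))
      simp only [if_pos hxv, if_pos hvu, pow_add]
    · exact Finset.sum_nonneg fun w _ => by positivity
  calc ∑ F ∈ tJoins G Set.univ {x, y}, ∑ L ∈ tJoins G Set.univ ∅,
        (if rch (cl F x ∪ L) x u then t ^ (#F + #L) else 0)
      ≤ ∑ F ∈ tJoins G Set.univ {x, y}, ∑ L ∈ tJoins G Set.univ ∅,
          ∑ v, (if rch F x v then t ^ #F else 0) * (if rch L v u then t ^ #L else 0) :=
        Finset.sum_le_sum fun F hF => Finset.sum_le_sum fun L hL => key F hF L hL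
    _ = ∑ v, ∑ F ∈ tJoins G Set.univ {x, y}, ∑ L ∈ tJoins G Set.univ ∅,
          (if rch F x v then t ^ #F else 0) * (if rch L v u then t ^ #L else 0) := by
        have hA : ∀ F ∈ tJoins G Set.univ {x, y},
            ∑ L ∈ tJoins G Set.univ ∅, ∑ v, (if rch F x v then t ^ #F else 0) * (if rch L v u then t ^ #L else 0)
              = ∑ v, ∑ L ∈ tJoins G Set.univ ∅,
                  (if rch F x v then t ^ #F else 0) * (if rch L v u then t ^ #L else 0) :=
          fun F _ => Finset.sum_comm
        rw [Finset.sum_congr rfl hA, Finset.sum_comm]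
    _ = ∑ v, (∑ F ∈ (tJoins G Set.univ {x, y}).filter (fun F => rch F x v), t ^ #F) *
          (∑ L ∈ (tJoins G Set.univ ∅).filter (fun L => rch L v u), t ^ #L) := by
        refine Finset.sum_congr rfl fun v _ => ?_
        rw [Finset.sum_filter, Finset.sum_filter, Finset.sum_mul_sum]

/-- `fullMass ≥ 0` for `t ≥ 0`. -/
theorem fullMass_nonneg {t : ℝ} (ht : 0 ≤ t) (x y u : V) : 0 ≤ fullMass G t x y u := by
  rw [fullMass_eq_sum_tJoins]
  refine Finset.sum_nonneg fun F _ => Finset.sum_nonneg fun L _ => ?_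
  split_ifs
  · positivity
  · exact le_rfl

/-- Off the diagonal the coincidence convention of `zPair` is invisible: `zPair G t x y = Z^{xy}` for
`x ≠ y`. -/
theorem soupAttach_zPair_of_ne (t : ℝ) {x y : V} (h : x ≠ y) :
    zPair G t x y = loopO1PartitionFunction G t {x, y} := by
  unfold zPair
  rw [Finset.symmDiff_eq_union (Finset.disjoint_singleton.2 h), ← Finset.insert_eq]

end General

/-! ### The box setting: the window never meets the sources -/

/-- **Edge case of the registered stub: a window point is never a source.**  For `l ≥ 1` a source
`a = l • tetra i` has all coordinates of modulus `l`, while `u ∈ window N l` has `2|uⱼ| ≤ l`; so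
`u ≠ a`, and in the stub `zPair G t (a 0) u = Z^{a₀u}`, `zPair G t u (a 1) = Z^{ua₁}` are genuine pair
partition functions (`soupAttach_zPair_of_ne`): nothing degenerates through the coincidence convention,
and the content of the stub is the `l`- (and `N`-) uniformity of its one constant. -/
theorem soupAttach_window_ne_source {l N : ℕ} (hl : 1 ≤ l) {i : Fin 4} {a : ↥(box 3 N)}
    (ha : ((a : Site 3)) = (l : ℤ) • tetra i) {u : ↥(box 3 N)} (hu : u ∈ window N l) : u ≠ a := by
  rintro rfl
  unfold window at hu
  rw [Finset.mem_filter] at hu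
  have h0 := hu.2 0
  rw [ha, Pi.smul_apply, smul_eq_mul, abs_mul, Nat.abs_cast] at h0
  have h1 : |tetra i 0| = 1 := by
    fin_cases i <;> simp [tetra]
  rw [h1, mul_one] at h0
  omega

end StubSoupAttach

/-! ### The registered auxiliary stub `stub_soupAttachDictionary` -/

open Summit.CriticalPhenomena.Ising3DConformalLimit.Cruxes.IndependentStrandsJoin.CrossFatteningDecoupling in
open scoped Classical in
/-- **Registered auxiliary stub `stub_soupAttachDictionary` of `stub_soupAttach`** (line
`cross-fattening-decoupling` of the crux `IndependentStrandsJoin`, stmt-CriticalPhenomena-14625; registered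
signature, verbatim): on every finite graph, for every real `t` and all `x y u`, the un-depleted one-point
mass is the double configuration sum
`fullMass G t x y u = Σ_{F ∈ 𝒯(xy)} Σ_{L ∈ 𝓔_∅(G)} t^{|F|+|L|}·1[x ↝_{K_x(F) ∪ L} u]`
(`= Z^{xy} Z^∅ · P_{ℓ^{xy} ⊗ ℓ^∅}[u ∈ C(x; K_x(F) ∪ L')]`).  This is `StubSoupAttach.fullMass_eq_sum_tJoins`;
the registered stub `stub_soupAttach` itself (the `l`-uniform one-point floor at `β_c`, `d = 3`) stays open. -/
theorem stub_soupAttachDictionary :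
    ∀ (V : Type) [Fintype V] [DecidableEq V] (G : SimpleGraph V) [DecidableRel G.Adj] (t : ℝ) (x y u : V),
      fullMass G t x y u = ∑ F ∈ tJoins G Set.univ {x, y}, ∑ L ∈ tJoins G Set.univ ∅,
        if rch (cl F x ∪ L) x u then t ^ (#F + #L) else 0 :=
  fun _ _ _ G _ t x y u => StubSoupAttach.fullMass_eq_sum_tJoins G t x y u

end Summit.CriticalPhenomena.Ising3DConformalLimit.Theorems

end
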